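import Literature.Barriers.Parity.SiegelZeroDichotomyChowlaStep3Mertens
import HarnessLib

/-!
# Tao–Teräväinen (3.3) with the gain: `∑_{p ≤ z} min(σ log_R p, 1)/p ≪ log(1 + σ log_R z)`

Topic `Literature/Barriers/Parity`, sub-namespace `TaoTeravainen`. The tree's
`SiegelZeroDichotomyChowlaStep3Mertens.sum_min_div_prime_le` is (3.3) of Tao–Teräväinen
(arXiv:2109.06291, §3.1) at `z = R` (bound `log σ + 30`); the proofs of (5.7) and (5.8) need the
general case `z = R₀ ≤ R`, where the right-hand side `log(1 + σ log_R z)` is SMALL for `z` much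
smaller than `R` — this is the source of the saving `log_R R₀` in (5.8) ("From (3.3) we have
`∏_{p ≤ R} E'_p(σ) ≪ exp(O(log(1 + σ log_R R₀)))`"). PROVED here with the absolute constant `40`,
from the tree's Mertens estimates (`MertensBound.sum_log_div_prime_le`, `MertensBound.sum_inv_prime_le`,
`Mertens.abs_primeRecipSum_sub_le`).

* **`sum_min_div_prime_le_log`** — for `2 ≤ M`, `σ ≥ 1`, `log M ≤ L`:
  `∑_{p ≤ M} min(σ log p/L, 1)/p ≤ 40 log(1 + σ log M/L)`.
[cite: TaoTeravainen2021, §3.1 (3.3)]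
-/

noncomputable section

open Finset Real

namespace Literature.Barriers.Parity

namespace TaoTeravainen

/-- **(3.3) in full** ("From Mertens' theorem we easily verify that
`∑_{p ≤ z} min(σ log_R p, 1)/p ≪ log(1 + σ log_R z)` for any `σ > 0` and `R, z ≥ 1`, as can be seen by
verifying the cases `σ log_R z < 1` and `σ log_R z ≥ 1` separately"), for `z = M ≥ 2` an integer,
`σ ≥ 1` and `L = log R ≥ log M`, with the absolute constant `40`:
`∑_{p ≤ M} min(σ log p / L, 1)/p ≤ 40 log(1 + σ log M / L)`. Case `σ log M ≤ L`: every term is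
`σ log p/(Lp)` and Mertens' first theorem gives `≤ 3 σ log M/L ≤ 6 log(1 + σ log M/L)`; otherwise the
primes with `σ log p ≤ L` contribute `≤ 3` (as in the tree's `sum_min_div_prime_le`) and the others lie
in `(e^{L/σ}, M]`, contributing `≤ log(σ log M/L) + 24` by the two-sided Mertens theorem.
[cite: TaoTeravainen2021, §3.1 (3.3)] -/
theorem sum_min_div_prime_le_log {M : ℕ} (hM : 2 ≤ M) {L σ : ℝ} (hσ : 1 ≤ σ) (hL : Real.log M ≤ L) :
    ∑ p ∈ Nat.primesBelow (M + 1), min (σ * Real.log p / L) 1 / p ≤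
      40 * Real.log (1 + σ * Real.log M / L) := by
  have hM2 : (2 : ℝ) ≤ M := by exact_mod_cast hM
  have hlogM : 0 < Real.log M := Real.log_pos (by linarith)
  have hlog2 : (0.6931471803 : ℝ) < Real.log 2 := Real.log_two_gt_d9
  have hlog2u : Real.log 2 < 0.6931471808 := Real.log_two_lt_d9
  have hlog2' : 0 < Real.log 2 := by linarith
  have hlog2M : Real.log 2 ≤ Real.log M := Real.log_le_log two_pos hM2
  have hL0 : 0 < L := by linarith
  have hσ0 : 0 < σ := by linarith
  set u : ℝ := σ * Real.log M / L with hu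
  have hu0 : 0 < u := by positivity
  have hlog1u : 0 < Real.log (1 + u) := Real.log_pos (by linarith)
  set S := Nat.primesBelow (M + 1) with hS
  have hSle : S = Nat.primesLE M := rfl
  have hmemS : ∀ p ∈ S, p.Prime ∧ p ≤ M := fun p hp => by
    rw [Nat.mem_primesBelow] at hp
    exact ⟨hp.2, Nat.lt_succ_iff.mp hp.1⟩
  set g : ℕ → ℝ := fun p => min (σ * Real.log p / L) 1 / p with hg
  have hg0 : ∀ p ∈ S, 0 ≤ g p := fun p hp => by
    have hp2 : (2 : ℝ) ≤ p := by exact_mod_cast (hmemS p hp).1.two_le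
    exact div_nonneg (le_min (by positivity) zero_le_one) (by linarith)
  -- the linear part of the sum is controlled by Mertens' first theorem
  have hlin : ∀ A ⊆ S, ∑ p ∈ A, σ * Real.log p / L / p ≤ σ / L * (Real.log M + Real.log 4) := by
    intro A hA
    have : ∑ p ∈ A, σ * Real.log p / L / p = σ / L * ∑ p ∈ A, Real.log p / p := by
      rw [Finset.mul_sum]
      exact Finset.sum_congr rfl fun p _ => by ring
    rw [this]
    refine mul_le_mul_of_nonneg_left ?_ (by positivity)
    calc ∑ p ∈ A, Real.log p / p ≤ ∑ p ∈ Nat.primesLE M, Real.log p / p := by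
          refine Finset.sum_le_sum_of_subset_of_nonneg (hA.trans (by rw [hSle])) fun p hp _ => ?_
          have := (Nat.mem_primesBelow.mp hp).2
          exact div_nonneg (Real.log_nonneg (by exact_mod_cast this.one_lt.le)) (Nat.cast_nonneg _)
      _ ≤ Real.log M + Real.log 4 :=
          Literature.NumberTheory.LFunctions.MertensBound.sum_log_div_prime_le M
  have h4 : Real.log 4 = 2 * Real.log 2 := by
    rw [show (4 : ℝ) = 2 ^ 2 by norm_num, Real.log_pow]; norm_num
  by_cases hcase : σ * Real.log M ≤ L
  · -- Case `u ≤ 1`: all terms are linear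
    have hu1 : u ≤ 1 := by rwa [hu, div_le_one hL0]
    have hall : ∑ p ∈ S, g p = ∑ p ∈ S, σ * Real.log p / L / p := by
      refine Finset.sum_congr rfl fun p hp => ?_
      obtain ⟨hpp, hpM⟩ := hmemS p hp
      have hp0 : (0 : ℝ) < p := by exact_mod_cast hpp.pos
      have hlogp : σ * Real.log p ≤ L :=
        (mul_le_mul_of_nonneg_left (Real.log_le_log hp0 (by exact_mod_cast hpM)) hσ0.le).trans hcase
      simp only [hg]
      rw [min_eq_left (by rw [div_le_one hL0]; exact hlogp)]
    rw [hall]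
    have hσL : σ / L ≤ u / Real.log 2 := by
      rw [hu, div_le_div_iff₀ hL0 hlog2', div_mul_cancel₀ _ hL0.ne']
      exact mul_le_mul_of_nonneg_left hlog2M hσ0.le
    -- `log(1+u) ≥ u/(1+u) ≥ u/2`
    have hlog_lb : u / 2 ≤ Real.log (1 + u) := by
      have h1 := Real.one_sub_inv_le_log_of_pos (by linarith : (0 : ℝ) < 1 + u)
      have h2 : 1 - (1 + u)⁻¹ = u / (1 + u) := by field_simp; ring
      rw [h2] at h1
      have h3 : u / 2 ≤ u / (1 + u) := div_le_div_of_nonneg_left hu0.le (by linarith) (by linarith)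
      linarith
    calc ∑ p ∈ S, σ * Real.log p / L / p ≤ σ / L * (Real.log M + Real.log 4) := hlin S le_rfl
      _ = u + σ / L * Real.log 4 := by rw [hu]; ring
      _ ≤ u + u / Real.log 2 * Real.log 4 := by gcongr
      _ = 3 * u := by rw [h4]; field_simp; ring
      _ ≤ 40 * Real.log (1 + u) := by linarith
  · -- Case `u > 1`
    have hu1 : 1 < u := by
      rw [hu, lt_div_iff₀ hL0, one_mul]
      exact lt_of_not_ge hcase
    have hlogu0 : 0 ≤ Real.log u := Real.log_nonneg hu1.le
    have hlogu : Real.log u ≤ Real.log (1 + u) := Real.log_le_log hu0 (by linarith)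
    have hlog1u2 : Real.log 2 ≤ Real.log (1 + u) := Real.log_le_log two_pos (by linarith)
    rw [← Finset.sum_filter_add_sum_filter_not S (fun p : ℕ => σ * Real.log (p : ℝ) ≤ L)]
    -- low part (as in the tree's `sum_min_div_prime_le`)
    have hlow : ∑ p ∈ S.filter (fun p : ℕ => σ * Real.log (p : ℝ) ≤ L), g p ≤ 3 := by
      set A := S.filter (fun p : ℕ => σ * Real.log (p : ℝ) ≤ L) with hA
      rcases A.eq_empty_or_nonempty with hAe | ⟨p₀, hp₀⟩
      · rw [hAe, sum_empty]; norm_num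
      · obtain ⟨hp₀S, hp₀L⟩ := mem_filter.mp hp₀
        have hp₀2 : (2 : ℝ) ≤ p₀ := by exact_mod_cast (hmemS p₀ hp₀S).1.two_le
        have hσL : σ * Real.log 2 ≤ L :=
          (mul_le_mul_of_nonneg_left (Real.log_le_log two_pos hp₀2) hσ0.le).trans hp₀L
        set m : ℕ := min M ⌊Real.exp (L / σ)⌋₊ with hm
        have hAsub : A ⊆ Nat.primesLE m := by
          intro p hp
          obtain ⟨hpS, hpL⟩ := mem_filter.mp hp
          obtain ⟨hpp, hpM⟩ := hmemS p hpS
          rw [Nat.primesLE, Nat.mem_primesBelow, Nat.lt_succ_iff]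
          refine ⟨le_min hpM (Nat.le_floor ?_), hpp⟩
          have hp0 : (0 : ℝ) < p := by exact_mod_cast hpp.pos
          rw [← Real.log_le_iff_le_exp hp0, le_div_iff₀ hσ0, mul_comm]
          exact hpL
        have hsum : ∑ p ∈ A, g p = σ / L * ∑ p ∈ A, Real.log p / p := by
          rw [Finset.mul_sum]
          refine sum_congr rfl fun p hp => ?_
          obtain ⟨-, hpL⟩ := mem_filter.mp hp
          rw [hg]
          dsimp only
          rw [min_eq_left (by rw [div_le_one hL0]; exact hpL)]
          ring
        have hlogm : Real.log m ≤ L / σ := by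
          rcases Nat.eq_zero_or_pos m with hm0 | hm0
          · rw [hm0, Nat.cast_zero, Real.log_zero]; positivity
          · calc Real.log m ≤ Real.log (Real.exp (L / σ)) := by
                  refine Real.log_le_log (by exact_mod_cast hm0) ?_
                  exact (Nat.cast_le.mpr (min_le_right _ _)).trans (Nat.floor_le (Real.exp_pos _).le)
              _ = L / σ := Real.log_exp _
        calc ∑ p ∈ A, g p = σ / L * ∑ p ∈ A, Real.log p / p := hsum
          _ ≤ σ / L * ∑ p ∈ Nat.primesLE m, Real.log p / p := by
              refine mul_le_mul_of_nonneg_left (sum_le_sum_of_subset_of_nonneg hAsub fun p hp _ => ?_)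
                (by positivity)
              have := (Nat.mem_primesBelow.mp hp).2
              exact div_nonneg (Real.log_nonneg (by exact_mod_cast this.one_lt.le)) (Nat.cast_nonneg _)
          _ ≤ σ / L * (Real.log m + Real.log 4) := mul_le_mul_of_nonneg_left
              (Literature.NumberTheory.LFunctions.MertensBound.sum_log_div_prime_le m) (by positivity)
          _ ≤ σ / L * (L / σ + Real.log 4) := by gcongr
          _ = 1 + σ * Real.log 4 / L := by field_simp
          _ ≤ 3 := by
              have h5 : σ * Real.log 4 / L ≤ 2 := by
                rw [h4, div_le_iff₀ hL0]; nlinarith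
              linarith
    -- high part: primes `p > y = e^{L/σ}`
    have hhigh : ∑ p ∈ S.filter (fun p : ℕ => ¬ σ * Real.log (p : ℝ) ≤ L), g p ≤ Real.log u + 24 := by
      set B := S.filter (fun p : ℕ => ¬ σ * Real.log (p : ℝ) ≤ L) with hB
      have hBle : ∑ p ∈ B, g p ≤ ∑ p ∈ B, (p : ℝ)⁻¹ := by
        refine sum_le_sum fun p hp => ?_
        have hp0 : (0 : ℝ) < p := by exact_mod_cast (hmemS p (mem_filter.mp hp).1).1.pos
        rw [hg]; dsimp only
        rw [div_le_iff₀ hp0, inv_mul_cancel₀ hp0.ne']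
        exact min_le_right _ _
      refine hBle.trans ?_
      set y : ℝ := Real.exp (L / σ) with hy
      have hy0 : 0 < y := Real.exp_pos _
      have hlogy : Real.log y = L / σ := Real.log_exp _
      have hBy : ∀ p ∈ B, y < p := by
        intro p hp
        obtain ⟨hpS, hpL⟩ := mem_filter.mp hp
        have hp0 : (0 : ℝ) < p := by exact_mod_cast (hmemS p hpS).1.pos
        rw [not_le] at hpL
        rw [← Real.log_lt_log_iff hy0 hp0, hlogy, div_lt_iff₀ hσ0, mul_comm]
        exact hpL
      -- `log log M - log log y = log u`
      have hll : Real.log (Real.log M) - Real.log (Real.log y) = Real.log u := by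
        rw [hlogy, hu, ← Real.log_div hlogM.ne' (by positivity)]
        congr 1
        field_simp
      rcases lt_or_ge y 2 with hy2 | hy2
      · -- `y < 2`: `L/σ < log 2 < 1`, so `log log M < log u`
        have hLσ : L / σ < Real.log 2 := by
          have : Real.log y < Real.log 2 := Real.log_lt_log hy0 hy2
          rwa [hlogy] at this
        have hllM : Real.log (Real.log M) ≤ Real.log u := by
          have hneg : Real.log (Real.log y) < 0 := by
            rw [hlogy]
            exact Real.log_neg (by positivity) (by linarith)
          linarith
        calc ∑ p ∈ B, (p : ℝ)⁻¹ ≤ ∑ p ∈ S, (p : ℝ)⁻¹ :=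
              sum_le_sum_of_subset_of_nonneg (filter_subset _ _) fun p _ _ => by positivity
          _ = ∑ p ∈ Nat.primesLE M, (1 : ℝ) / p := by rw [hSle]; simp
          _ ≤ Real.log (Real.log M) + 4 :=
              Literature.NumberTheory.LFunctions.MertensBound.sum_inv_prime_le M hM
          _ ≤ Real.log u + 24 := by linarith
      · rcases lt_or_ge (M : ℝ) y with hMy | hyM
        · -- `y > M`: no primes
          have hBe : B = ∅ := by
            refine Finset.filter_eq_empty_iff.mpr fun p hp hpL => ?_
            have h1 := hBy p (mem_filter.mpr ⟨hp, hpL⟩)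
            have h2 : (p : ℝ) ≤ M := by exact_mod_cast (hmemS p hp).2
            linarith
          rw [hBe, sum_empty]
          linarith
        · have hsub : Nat.primesLE ⌊y⌋₊ ⊆ Nat.primesLE M := by
            intro p hp
            rw [Nat.primesLE, Nat.mem_primesBelow, Nat.lt_succ_iff] at hp ⊢
            exact ⟨hp.1.trans (Nat.floor_le_of_le (by simpa using hyM)), hp.2⟩
          have hBsub : B ⊆ Nat.primesLE M \ Nat.primesLE ⌊y⌋₊ := by
            intro p hp
            rw [mem_sdiff]
            refine ⟨by rw [← hSle]; exact (mem_filter.mp hp).1, fun h => ?_⟩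
            rw [Nat.primesLE, Nat.mem_primesBelow, Nat.lt_succ_iff] at h
            have h1 : (p : ℝ) ≤ ⌊y⌋₊ := by exact_mod_cast h.1
            linarith [Nat.floor_le hy0.le, hBy p hp]
          have hdiff : ∑ p ∈ Nat.primesLE M \ Nat.primesLE ⌊y⌋₊, (p : ℝ)⁻¹ =
              Literature.NumberTheory.LFunctions.Mertens.primeRecipSum M -
                Literature.NumberTheory.LFunctions.Mertens.primeRecipSum y := by
            rw [Literature.NumberTheory.LFunctions.Mertens.primeRecipSum,
              Literature.NumberTheory.LFunctions.Mertens.primeRecipSum, Nat.floor_natCast,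
              eq_sub_iff_add_eq, sum_sdiff hsub]
          have h1 := Literature.NumberTheory.LFunctions.Mertens.abs_primeRecipSum_sub_le hM2
          have h2 := Literature.NumberTheory.LFunctions.Mertens.abs_primeRecipSum_sub_le hy2
          rw [abs_le] at h1 h2
          have hlog2y : Real.log 2 ≤ Real.log y := Real.log_le_log two_pos hy2
          have hlogy0 : 0 < Real.log y := by linarith
          have e1 : 8 / Real.log M ≤ 8 / Real.log 2 :=
            div_le_div_of_nonneg_left (by norm_num) hlog2' (Real.log_le_log two_pos hM2)
          have e2 : 8 / Real.log y ≤ 8 / Real.log 2 := div_le_div_of_nonneg_left (by norm_num) hlog2' hlog2y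
          have e3 : 8 / Real.log 2 ≤ 12 := by rw [div_le_iff₀ hlog2']; linarith
          calc ∑ p ∈ B, (p : ℝ)⁻¹ ≤ ∑ p ∈ Nat.primesLE M \ Nat.primesLE ⌊y⌋₊, (p : ℝ)⁻¹ :=
                sum_le_sum_of_subset_of_nonneg hBsub fun p _ _ => by positivity
            _ = _ := hdiff
            _ ≤ Real.log u + 24 := by linarith
    have h27 : (27 : ℝ) ≤ 39 * Real.log (1 + u) := by nlinarith
    linarith

end TaoTeravainen

end Literature.Barriers.Parity
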